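import Summits.Parity.GeneralizedHardyLittlewood.Theorems.Dhl42MainI

/-!
# DHL[42,2] certificate — `I(F₀)` in closed form, part 2: `Ival = pairedI` (Lemma 6.1(b), §6.2)

`I(F₀) = ∫ F₀²` is reduced to four one-dimensional pairings of convolution densities with polynomial
weights: the weights `Φ²`, `Φχ`, `χ²` are test functions on `[0, S]`;
`Ival_classes : I(F₀) = V_A + 84 V_B + 42 V_C + 1722 V_D` (`integral_classes` at `n + 3 = 42`); each
class integral is a simplex integral of `Π_j f_j(t_j) φ(Σt)`, hence (`Dhl42Density`) the pairing
`∫_0^S (dens f)(v) φ(v) dv`, split at `K` where the weights are polynomials (`pairing_lo/hi/split`,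
`VA_eq` … `VD_eq`); whence **`Ival_eq_pairedI : Ival = pairedI`**, an identity between `I(F₀)` and
an explicit real number built from `ExpPoly` objects only (no literal data involved). The kernel
bridge (`Dhl42KernelBridge`, later in the batch) identifies `pairedI` with the exact 23-term value
`iSum` of `Dhl42MainTerms`.

Origin: `Dhl42/ClosedForm/MainI.lean` of the DHL[42,2] certificate package (pub-dhl42 bundle,
archive blob `18cce9e3`; sha256[:16] of the file `1ed72deade926703`; paper snapshot =
`paper/main.tex` v1), lines :343–:491; statements and proofs unchanged except: namespace
`Dhl42.ClosedForm` → `Summit.Parity.GeneralizedHardyLittlewood.Theorems.Dhl42.ClosedForm`,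
`open TpY4Dhl42` dropped (the certificate's Part 1–7 declarations, migrated to
`Summit.Parity.GeneralizedHardyLittlewood.Theorems.Dhl42` in batches B2/B3, are in scope in the
sub-namespace), `Dhl42.ExpPoly` → the tree's `Literature.Analysis.ValidatedNumerics.ExpPoly`
(`ExpPoly/*.lean`, batch B1), the package's `simplexSet n B` replaced by the tree's definitionally
equal `Literature.NumberTheory.Sieve.scaledSimplex n B` (also inside the names of the B2/B3 lemmas
used), docstrings added where missing. Package-internal references in the verbatim docstrings
(`Density.lean`, `Setup.lean`, `KernelBridge.lean`, `MainI.…`) refer to that package (paper Appendix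
B).

Declarations (25): `exists_bound_Phi`, `exists_bound_chi`, `testFn_wA`, `testFn_wB`, `testFn_wC`,
`VA`, `VB`, `VC`, `VD`, `Sc_nonneg`, `Kc_nonneg`, `Kc_le_Sc`, `Ival_classes`,
`intervalIntegrable_of_bdd`, `ii_pairing`, `eval_single`, `pairing_lo`, `pairing_hi`,
`pairing_hi_zero`, `pairing_split`, `VA_eq`, `VB_eq`, `VC_eq`, `VD_eq`, `Ival_eq_pairedI`.
-/

open MeasureTheory Set Filter Real intervalIntegral
open Literature.Analysis.ValidatedNumerics.ExpPoly
open Literature.NumberTheory.Sieve (scaledSimplex)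

namespace Summit.Parity.GeneralizedHardyLittlewood.Theorems.Dhl42.ClosedForm

noncomputable section

/-! ### Test-function bounds for the weights of `I(F₀)` -/

/-- `Φ` is bounded on `[0, S]`. -/
theorem exists_bound_Phi : ∃ C, 0 ≤ C ∧ ∀ v ∈ Icc 0 Sc, |Phi v| ≤ C := by
  obtain ⟨C1, hC10, hC1⟩ := exists_bound_Icc_of_continuous continuous_PhiPoly 0 Sc
  obtain ⟨C2, hC20, hC2⟩ := exists_bound_Icc_of_continuous continuous_PhiCut 0 Sc
  exact ⟨C1 + C2, by positivity, fun v hv => (abs_Phi_le v).trans (add_le_add (hC1 v hv) (hC2 v hv))⟩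

/-- `χ` is bounded on `[0, S]`. -/
theorem exists_bound_chi : ∃ C, 0 ≤ C ∧ ∀ v ∈ Icc 0 Sc, |chi v| ≤ C := by
  obtain ⟨C, hC0, hC⟩ := exists_bound_Icc_of_continuous continuous_chiPoly 0 Sc
  exact ⟨C, hC0, fun v hv => (abs_chi_le v).trans (hC v hv)⟩

/-- The weight `Φ²` of `I(F₀)` is a test function on `[0, S]` (measurable, bounded). -/
theorem testFn_wA : TestFn Sc fun v => Phi v ^ 2 := by
  obtain ⟨C, hC0, hC⟩ := exists_bound_Phi
  refine ⟨measurable_Phi.pow_const 2, C ^ 2, by positivity, fun v hv => ?_⟩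
  show |Phi v ^ 2| ≤ C ^ 2
  rw [abs_pow]; exact pow_le_pow_left₀ (abs_nonneg _) (hC v hv) 2

/-- The weight `Φχ` of `I(F₀)` is a test function on `[0, S]`. -/
theorem testFn_wB : TestFn Sc fun v => Phi v * chi v := by
  obtain ⟨C, hC0, hC⟩ := exists_bound_Phi
  obtain ⟨D, hD0, hD⟩ := exists_bound_chi
  refine ⟨measurable_Phi.mul measurable_chi, C * D, by positivity, fun v hv => ?_⟩
  show |Phi v * chi v| ≤ C * D
  rw [abs_mul]; exact mul_le_mul (hC v hv) (hD v hv) (abs_nonneg _) hC0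

/-- The weight `χ²` of `I(F₀)` is a test function on `[0, S]`. -/
theorem testFn_wC : TestFn Sc fun v => chi v ^ 2 := by
  obtain ⟨D, hD0, hD⟩ := exists_bound_chi
  refine ⟨measurable_chi.pow_const 2, D ^ 2, by positivity, fun v hv => ?_⟩
  show |chi v ^ 2| ≤ D ^ 2
  rw [abs_pow]; exact pow_le_pow_left₀ (abs_nonneg _) (hD v hv) 2

/-! ### `I(F₀)` as a combination of the four class integrals -/

/-- The four class integrals (`42 = 39 + 3` coordinates, in the form produced by
`integral_classes`). -/
def VA : ℝ := ∫ t, simplexIntegrand (39 + 2) (fun _ => GE) Sc (fun v => Phi v ^ 2) t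
/-- Class-B integral of `I(F₀)`: one factor `gh`, weight `Φχ`, on `S·R_42`. -/
def VB : ℝ := ∫ t, simplexIntegrand (39 + 2) (gB (39 + 1)) Sc (fun v => Phi v * chi v) t
/-- Class-C integral of `I(F₀)`: one factor `h²`, weight `χ²`, on `S·R_42`. -/
def VC : ℝ := ∫ t, simplexIntegrand (39 + 2) (gC (39 + 1)) Sc (fun v => chi v ^ 2) t
/-- Class-D integral of `I(F₀)`: two factors `gh`, weight `χ²`, on `S·R_42`. -/
def VD : ℝ := ∫ t, simplexIntegrand (39 + 2) (gD 39) Sc (fun v => chi v ^ 2) t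

/-- `0 ≤ S`. -/
theorem Sc_nonneg : 0 ≤ Sc := by norm_num [Sc, eps]
/-- `0 ≤ K`. -/
theorem Kc_nonneg : 0 ≤ Kc := by norm_num [Kc, eps]
/-- `K ≤ S`. -/
theorem Kc_le_Sc : Kc ≤ Sc := by norm_num [Kc, Sc, eps]

/-- **`I(F₀)` by symmetry classes** (§6.2): expanding `F₀² = (Π g)² (Φ + χ Σ_l η_l)²` and collecting
equal integrals under permutations, `I(F₀) = V_A + 2·42 V_B + 42 V_C + 42·41 V_D`. -/
theorem Ival_classes : Ival = VA + 84 * VB + 42 * VC + 1722 * VD := by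
  have hF : ∀ t, F0 t ^ 2 = (scaledSimplex 42 Sc).indicator
      (fun t => ((∏ j, gfun (t j)) * (Phi (∑ j, t j) + chi (∑ j, t j) * ∑ l, hfun (t l) / gfun (t l))) ^ 2) t := by
    intro t
    unfold F0 Rmark
    by_cases ht : t ∈ scaledSimplex 42 Sc
    · rw [indicator_of_mem ht, indicator_of_mem ht]
    · rw [indicator_of_notMem ht, indicator_of_notMem ht]; simp
  unfold Ival
  simp_rw [hF]
  refine (integral_classes (n := 39) Sc testFn_wA testFn_wB testFn_wC).trans ?_
  rw [VA, VB, VC, VD]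
  push_cast
  ring

/-! ### From class integrals to pairings -/

/-- A measurable function bounded on `[a, b]` is interval integrable on `[a, b]`. -/
theorem intervalIntegrable_of_bdd {f : ℝ → ℝ} (hf : Measurable f) {a b C : ℝ} (hab : a ≤ b)
    (hb : ∀ x ∈ Icc a b, |f x| ≤ C) : IntervalIntegrable f volume a b := by
  rw [intervalIntegrable_iff, uIoc_of_le hab]
  refine Measure.integrableOn_of_bounded (M := C) measure_Ioc_lt_top.ne hf.aestronglyMeasurable ?_
  exact ae_restrict_of_forall_mem measurableSet_Ioc fun x hx => by
    rw [Real.norm_eq_abs]; exact hb x (Ioc_subset_Icc_self hx)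

/-- The integrand `D(v) w(v)` of a pairing is interval integrable on subintervals of `[0, S]`. -/
theorem ii_pairing (D : EP) {w : ℝ → ℝ} (hw : TestFn Sc w) {a b : ℝ} (ha : 0 ≤ a) (hab : a ≤ b)
    (hb : b ≤ Sc) : IntervalIntegrable (fun v => EP.eval D v * w v) volume a b := by
  obtain ⟨C1, hC10, hC1⟩ := EP.exists_bound_Icc D 0 Sc
  obtain ⟨C2, hC20, hC2⟩ := hw.bdd
  refine intervalIntegrable_of_bdd (f := fun v => EP.eval D v * w v)
    ((EP.continuous_eval D).measurable.mul hw.measurable) (C := C1 * C2) hab fun x hx => ?_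
  have hx' : x ∈ Icc 0 Sc := ⟨ha.trans hx.1, hx.2.trans hb⟩
  rw [abs_mul]; exact mul_le_mul (hC1 x hx') (hC2 x hx') (abs_nonneg _) hC10

/-- A one-block exp-polynomial `[(0, 0, p)]` denotes the polynomial `p`. -/
theorem eval_single (p : Poly) (x : ℝ) : EP.eval [⟨0, 0, p⟩] x = Poly.eval p x := by
  simp [EP.eval, Blk.eval]

/-- Lower piece of a pairing. -/
theorem pairing_lo (D : EP) (w : ℝ → ℝ) (p : Poly) (hlo : ∀ x ∈ Icc 0 Kc, w x = Poly.eval p x) :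
    ∫ v in (0 : ℝ)..Kc, EP.eval D v * w v = FS.eval (EP.integ (EP.merge (EP.mul D [⟨0, 0, p⟩])) 0 Kq) := by
  rw [EP.eval_integ, Rat.cast_zero, Kq_cast]
  apply intervalIntegral.integral_congr
  intro x hx
  rw [uIcc_of_le Kc_nonneg] at hx
  simp only [EP.eval_merge, EP.eval_mul, eval_single, hlo x hx]

/-- Upper piece of a pairing. -/
theorem pairing_hi (D : EP) (w : ℝ → ℝ) (p : Poly) (hhi : ∀ x ∈ Ioc Kc Sc, w x = Poly.eval p x) :
    ∫ v in Kc..Sc, EP.eval D v * w v = FS.eval (EP.integ (EP.merge (EP.mul D [⟨0, 0, p⟩])) Kq Sq) := by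
  rw [EP.eval_integ, Sq_cast, Kq_cast, integral_of_le Kc_le_Sc, integral_of_le Kc_le_Sc]
  apply setIntegral_congr_fun measurableSet_Ioc
  intro x hx
  simp only [EP.eval_merge, EP.eval_mul, eval_single, hhi x hx]

/-- Upper piece vanishing. -/
theorem pairing_hi_zero (D : EP) (w : ℝ → ℝ) (hhi : ∀ x ∈ Ioc Kc Sc, w x = 0) :
    ∫ v in Kc..Sc, EP.eval D v * w v = 0 := by
  rw [integral_of_le Kc_le_Sc]
  rw [setIntegral_congr_fun measurableSet_Ioc (g := fun _ => (0 : ℝ)) fun x hx => by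
    simp only [hhi x hx, mul_zero]]
  simp

/-- `∫_0^S = ∫_0^K + ∫_K^S` for the pairing integrand `⟦D⟧ w` of a test function `w` on `[0, S]`. -/
theorem pairing_split (D : EP) {w : ℝ → ℝ} (hw : TestFn Sc w) :
    ∫ v in (0 : ℝ)..Sc, EP.eval D v * w v =
      (∫ v in (0 : ℝ)..Kc, EP.eval D v * w v) + ∫ v in Kc..Sc, EP.eval D v * w v :=
  (integral_add_adjacent_intervals (ii_pairing D hw le_rfl Kc_nonneg Kc_le_Sc)
    (ii_pairing D hw Kc_nonneg Kc_le_Sc le_rfl)).symm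

/-! ### The four class values -/

/-- Class A evaluated: `V_A = ⟦pairLoHi D42 Φ²|_{[0,K]} Φ²|_{(K,S]}⟧` (Lemma 6.1(a) with the density
`G^{⋆42}`, split at `K`). -/
theorem VA_eq : VA = FS.eval (pairLoHi D42 WPhi2lo WPhi2hi) := by
  rw [VA, integral_simplex_eq_dens _ _ Sc Sc_nonneg _ testFn_wA, dens_const, pairLoHi, FS.eval_append,
    show EP.convIter GE (39 + 2) (ES.toEP GE) = D42 from rfl, pairing_split D42 testFn_wA,
    pairing_lo D42 _ (Poly.mul phiLo phiLo), pairing_hi D42 _ (Poly.mul phiS phiS)]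
  · rfl
  · intro x hx; rw [Phi_of_gt hx.1, Poly.eval_mul, pow_two]
  · intro x hx; rw [Phi_of_le hx.2, Poly.eval_mul, pow_two]

/-- Class B evaluated: `V_B = ⟦pairLo (gh ⋆ G^{⋆41}) (Φχ)⟧`. -/
theorem VB_eq : VB = FS.eval (pairLo (EP.conv GHE D41) WPhichi) := by
  rw [VB, gB, integral_simplex_eq_dens _ _ Sc Sc_nonneg _ testFn_wB, dens_cons, dens_const,
    show EP.convIter GE (39 + 1) (ES.toEP GE) = D41 from rfl, pairing_split _ testFn_wB,
    pairing_lo _ _ (Poly.mul phiLo chiK), pairing_hi_zero, add_zero]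
  · rfl
  · intro x hx; rw [chi_of_gt hx.1, mul_zero]
  · intro x hx; rw [Phi_of_le hx.2, chi_of_le hx.2, Poly.eval_mul]

/-- Class C evaluated: `V_C = ⟦pairLo (h² ⋆ G^{⋆41}) χ²⟧`. -/
theorem VC_eq : VC = FS.eval (pairLo (EP.conv H2E D41) Wchi2) := by
  rw [VC, gC, integral_simplex_eq_dens _ _ Sc Sc_nonneg _ testFn_wC, dens_cons, dens_const,
    show EP.convIter GE (39 + 1) (ES.toEP GE) = D41 from rfl, pairing_split _ testFn_wC,
    pairing_lo _ _ (Poly.mul chiK chiK), pairing_hi_zero, add_zero]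
  · rfl
  · intro x hx; rw [chi_of_gt hx.1]; simp
  · intro x hx; rw [chi_of_le hx.2, Poly.eval_mul, pow_two]

/-- Class D evaluated: `V_D = ⟦pairLo (gh ⋆ gh ⋆ G^{⋆40}) χ²⟧`. -/
theorem VD_eq : VD = FS.eval (pairLo (EP.conv GHE (EP.conv GHE D40)) Wchi2) := by
  rw [VD, gD, integral_simplex_eq_dens _ _ Sc Sc_nonneg _ testFn_wC, dens_cons, dens_cons,
    dens_const, show EP.convIter GE 39 (ES.toEP GE) = D40 from rfl, pairing_split _ testFn_wC,
    pairing_lo _ _ (Poly.mul chiK chiK), pairing_hi_zero, add_zero]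
  · rfl
  · intro x hx; rw [chi_of_gt hx.1]; simp
  · intro x hx; rw [chi_of_le hx.2, Poly.eval_mul, pow_two]

/-- **`I(F₀)` in closed form, analytic half**: `I(F₀)` equals the explicit exp-polynomial pairing
expression `pairedI` (paper Lemma 6.1(b) with §6.2; no literal data involved). -/
theorem Ival_eq_pairedI : Ival = pairedI := by
  rw [Ival_classes, VA_eq, VB_eq, VC_eq, VD_eq, pairedI]

end

end Summit.Parity.GeneralizedHardyLittlewood.Theorems.Dhl42.ClosedForm
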